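import Mathlib
import HarnessLib
import HarnessLib.Audit
import Summits.AnomalousDissipation.Statement
import Literature.Analysis.FluidPDE.StokesTorus
import HarnessLib.Audit.Status.Attr

/-!
Route: ImpulseGrid

DORMANT since 2026-08-24T06:17:32Z (reconciler: no traction for 6.6 d (last activity item-evidence-added at 2026-08-17T15:53:08Z); parked, not closed — `ledger route dormant route-AnomalousDissipation-ImpulseGrid --off` to reactivate) — unstaffed, not closed; items shared with open routes are served there. `ledger route dormant <id> --off` reactivates.

# Route ImpulseGrid — AnomalousDissipation (realises idea card impulse-ito-kick-grid-no-reversal,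
incarnation (G): a force slab crossed by a mean flow — "a grid in a wind tunnel on T³")

## Thesis X (words)
Force f(x) = Φ(x₀)·G(x₁,x₂): a slab profile Φ (unit mass, a function of the streamwise coordinate x₀
only) carrying a smooth TRANSVERSE pattern G ⊥ e₀ (div G = 0, mean zero, independent of x₀; intended
design: a fine-mesh cellular array at transverse wavenumber m ≫ 1 in a thin slab), and data of total
momentum c·e₀, c > 0 (conserved for a mean-zero force: the fluid circulates through the "grid" once
per time 1/c, each column receiving the impulse G/c per pass). Let Ψ be the zero-mean sawtooth with
∂₀Ψ = Φ − 1 (Ψ ≈ ½ − x₀ downstream of the slab), Φ₀ := Ψ·G, w := u − c·e₀, and Λ a generalized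
(Banach) long-time limit (Literature.Analysis.FluidPDE.GeneralizedLimit). X says: for some such
design and some η > 0 there are ν_j → 0 and global Leray–Hopf solutions u_j with (i) bounded mean
energy (plus, per j, a sup-in-time energy bound — automatic at ν_j > 0,
Correlation.AbsorbingBallLHTorus), (ii) no Leray–Hopf leakage in the mean (⟨(f,u_j)⟩ ≤
ν_j⟨‖∇u_j‖²⟩), and the two GRID SIGN CONDITIONS
 (a) NO REVERSAL  Λ⟨(G,u_j)⟩ ≥ 0 — the circuit-averaged transverse flow is never anti-aligned with
the kicked pattern;
 (b) EARLY RELAXATION  Λ⟨∫ w_j·(w_j·∇)Φ₀⟩ ≤ −η — the transverse Reynolds stress works against ∇G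
predominantly in the first half-circuit behind the slab (net of the slab-vs-circuit difference of
the cross-moment ∫(Φ−1)w₀(w·G)).

## Why it suffices (X → AnomalousDissipation)
Testing the weak formulation with the steady divergence-free fields G and Φ₀ = Ψ·G gives, for EVERY
bounded-energy global LH solution and EVERY constant c, the exact GRID INJECTION IDENTITY
(whole-torus form, no Fubini; pointwise algebra ⟪u,(u·∇)(ΨG)⟫ = c·∂₀Ψ·⟪w,G⟫ + ⟪w,(w·∇)(ΨG)⟫ because
G₀ = 0 and ∂₀G = 0):
   c·Λ⟨(f,u)⟩ = c·Λ⟨(G,u)⟩ − Λ⟨∫ w·(w·∇)Φ₀⟩ − ν·Λ⟨(u,ΔΦ₀)⟩ − ∫ΦΨ|G|²      (last term = 0 by design),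
   Λ⟨∫ w·(w·∇)G⟩ = −∫Φ|G|² − ν·Λ⟨(u,ΔG)⟩                                    (pinned transverse
stress).
The second line is "Itô without noise": the force feeds the G-projection of momentum at the
STATE-INDEPENDENT rate ∫Φ|G|², whatever the flow does; the first converts that into ENERGY injection
= circuit-mean correlation + (how early behind the grid the imprint is destroyed). Hence (a) ∧ (b) ⇒
Λ⟨(f,u_j)⟩ ≥ (η − ν_j‖ΔΦ₀‖_∞(1+E)/2)/c ≥ η/(2c) for all large j; limsup-mean ≥ Λ-mean; and (ii)
turns injection into meanDissipation ≥ η/(2c) =: ε — the zeroth law after reindexing the tail of the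
family (energy bound and f smooth/div-free/mean-zero are clauses of X).

## Thesis X (Lean, one line — elaborates rc 0 as `GridThesis` in the planner's Sketch.lean; every
constant exists:
Literature.Analysis.FunctionSpaces.Torus.{IsSmooth,IsDivFree,HasZeroMean,partialDeriv,convect,laplacian,kineticEnergy},
Literature.Analysis.FluidPDE.Torus.IsGlobalLerayHopf,
Literature.Analysis.FluidPDE.{meanEnergy,meanDissipation,longTimeAvgSup,GeneralizedLimit.longTimeAvg})
∃ Φ Ψ G c η Λ, IsSmooth Φ ∧ IsSmooth Ψ ∧ IsSmooth G ∧ (∀ s x, Ψ (x + Pi.single 1 s) = Ψ x ∧ Ψ (x +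
Pi.single 2 s) = Ψ x) ∧ (∀ s x, G (x + Pi.single 0 s) = G x) ∧ (∀ x, G x 0 = 0) ∧ IsDivFree G ∧ (∀
x, partialDeriv 0 Ψ x = Φ x − 1) ∧ ∫ Φ·Ψ·‖G‖² = 0 ∧ IsSmooth f ∧ IsDivFree f ∧ HasZeroMean f ∧ 0 < c
∧ 0 < η ∧ ∃ ν u₀ u, (∀ j, 0 < ν j) ∧ Tendsto ν atTop (𝓝 0) ∧ (∀ j, IsGlobalLerayHopf (ν j) (fun _ =>
f) (u₀ j) (u j)) ∧ (∀ j, ∃ C, ∀ t ≥ 0, kineticEnergy (u j t) ≤ C) ∧ (∀ j, ∫ u₀ j = c • e₀) ∧ (∃ E, ∀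
j, meanEnergy (u j) ≤ E) ∧ (∀ j, longTimeAvgSup (t ↦ ∫⟪f, u j t⟫) ≤ meanDissipation (ν j) (u j)) ∧
(∀ j, 0 ≤ Λ.longTimeAvg (t ↦ ∫⟪G, u j t⟫)) ∧ (∀ j, Λ.longTimeAvg (t ↦ ∫⟪u j t − c•e₀, convect (u j t
− c•e₀) (Ψ•G)⟫) ≤ −η)
with f := fun x => Φ x • G x and e₀ := EuclideanSpace.single (0 : Fin 3) 1.

Rationale: WHY THIS LINE. Every injection-based route needs a FLOOR on a signed large-scale correlation
(Correlation crux 0201: ⟨(f,u_j)⟩ ≥ ε). Impulsive forcing has a state-independent work term — the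
deterministic twin of Itô's ½TrQ for white forcing (Novikov1965; Alvelius1999; random kicks:
KuksinShirikyan2012, KuksinPenrose2005; physics of kicked turbulence: Lohse2000): a kick g does work
½‖g‖² + (g, pre-kick state). On the steady summit the kick is delivered spatially: fluid drifting at
speed c through a thin force slab Φ(x₀)G(x⊥) receives G/c once per circuit. The EXACT grid injection
identity (thesis) moves the floor from "+ε correlation" to "the returning flow is not anti-aligned
(a) and the imprint is destroyed early behind the grid (b)". Physically this is grid turbulence,
where Re-independent dissipation is cleanest (decaying-grid C_ε plateau:
SinhuberBodenschatzBewley2015; Frisch1995 §5.2; caveat: near-field non-equilibrium scalings,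
Vassilicos2015, doi:10.1063/1.4973416). Imported area: stochastic-PDE energy bookkeeping
(Itô/Novikov balance) transplanted to deterministic LH weak solutions via Banach limits
(DoeringFoias2002 §2; FoiasManleyRosaTemam2001 Ch. IV–V). No spectral/probabilistic machinery beyond
that; the bet is a SIGN.
SELF-CONSISTENT REGIME (why the free half-kick can dominate): mesh M = 1/m ≪ 1, drift c, pattern
amplitude |G| with M·c² ≲ |G| ≪ c²: then u' ~ |G|/c ≪ c (Taylor's frozen-flow regime: the slab
crossing is impulsive) AND the eddy turnover at scale M, M·c/|G| ≲ 1/c, is shorter than the circuit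
time (the imprint decays before the column returns), so J(x₀) = (G, w̄(x₀)) jumps by |G|²/c at the
slab and relaxes to ≈ 0 within d_relax ~ c·Mc/|G| ≪ ½: (a) holds with J ≥ 0, (b) with η ≈ ½∫Φ|G|²,
injection ≈ |G|²/(2c) ν-independently. ε is small but FIXED — all the summit asks.
RANKED CRUXES. PROOF PATH (rev 5, route-choice repair 2026-08-16 after the operator hold
target-unreachable). The target #0 GridThesis is ONE ∃ over a family carrying three independent
burdens — ν-uniform bounded energy, no Leray–Hopf leakage in the mean, the grid signs; separately
filed ∃-pieces cannot be recombined (different witnesses), so exactly one piece stays existential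
and the other becomes a law over the class it produces. GridThesis is SPLIT (D-0019 glued split)
into
 · BoundedEnergyNoLeakGrid (crux; existence/regularity side; ∀ design ∃ family): for EVERY grid
design (unit-mass x⊥-invariant Φ, transverse x₀-invariant G, f = Φ•G smooth div-free mean-zero,
drift c > 0 — the clause list of #3 minus f ≠ 0) a vanishing-viscosity global LH family with drift
data, per-j sup-energy bounds (automatic: Correlation.AbsorbingBallLHTorus 0447), ν-uniformly
bounded mean energy AND mean energy equality ⟨(f,u_j)⟩ ≤ ν_j⟨‖∇u_j‖²⟩. No-leak rides with existence
because it is free for regular families (steady states with prescribed drift exist at every ν > 0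
and satisfy (f,u*) = ν‖∇u*‖²; periodic orbits likewise) and is open only as a law over all LH
solutions (FMRT p.71): this is the "same-family / ∀-form no-leak statement" announced at rev 3 in
place of the dropped Correlation.BoundedEnergyEquality (0202). Why it might fail: no ν-uniform
energy bound for any f ≠ 0 in 3-D (FMRT (13.11)); universality over designs dies on a 3-D
Marchioro-type laminar global attractor (none known; 3-D Kolmogorov flow at k_f = 1 is turbulent in
DNS, BorueOrszag1996).
 · GridSignsLaw (crux; the sign bet as a LAW; ∃ design ∀ family): some design (GridThesis design
clauses + the two Φ-clauses of #3) such that EVERY bounded-energy drift-c LH family with ν_j → 0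
admits η > 0, one Banach mean Λ and a threshold J with (a) 0 ≤ Λ⟨(G,u_j)⟩ and (b)
Λ⟨∫⟪w_j,(w_j·∇)(ΨG)⟫⟩ ≤ −η for j ≥ J ("eventually": viscous members have w_j small and (b) ≈ 0). A
prediction about every finite-energy wake of the grid, not about one hand-picked family; G = 0 or Ψ
= 0 make (b) false, and vacuous truth would itself be a 3-D Marchioro theorem. Why it might fail: as
#2, now for ALL finite-energy wakes of the design (phase-locked coherent recoil).
 · GridThesisGlue (support): BoundedEnergyNoLeakGrid → GridSignsLaw → GridThesis — pure logic plus
the tail shift j ↦ j+J (Filter.tendsto_add_atTop_iff_nat); PROVED in the planner's Sketch.lean (rc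
0, 0 sorries, ~20 lines; attached as evidence), landable verbatim.
 NECESSARY-CONDITION HANDLES (top level, statements unchanged, why-might-fail in their docstrings):
#2 GridSigns (the thesis minus no-leakage and sup-energy; synchronised recoil / Kirchhoff-ellipse
perfect recoil in 2-D Euler, 2-D-isation AlexakisDoering2006PLA, energy-sized cross-moment off the
Taylor regime; only c·(a) − (b) ≥ η is load-bearing) and #3 BoundedEnergyGrid (rev 3, unit-mass
clause ∫Φ = 1 kills the detuned laminar swept witnesses; the resonant slab mean makes every laminar
response ∝ ν⁻²; implies Correlation.BoundedEnergyFamily 0203). Logical map: GridThesis ⇒ GridSigns ⇒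
BoundedEnergyGrid (∫Φ = 1 ⇐ ∂₀Ψ = Φ − 1; f ≠ 0 ⇐ (b)); BoundedEnergyNoLeakGrid at any nontrivial
design ⇒ BoundedEnergyGrid; GridSignsLaw ∧ (a bounded-energy drift family of its design) ⇒
GridSigns. So #2/#3 are the cheapest statements whose REFUTATION closes the route; the children of
#0 are the statements whose PROOF closes it.
SUPPORT (provable now): MeanMomentumBalance (weak form tested with χ(t)Φ₀(x), Cesàro, Banach limit;
reusable by the crossflow/Ważewski/dual-budget cards); GridInjectionIdentity (from it by the
pointwise algebra of the thesis; both conjuncts; sup-energy hypothesis =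
Correlation.AbsorbingBallLHTorus 0447, not re-filed); GridThesisGlue; KickLemma (time-domain twin
for kick trains, |W_n − ½‖g‖² − (g,u(nT))| ≤ K_g(1+E)δ in the LH class, ν-uniform — NOT in the
assembly; one-sided reduction of the registered open S03 =
Literature.Analysis.FluidPDE.ZerothLawTimePeriodic, kept because the refuter audit asked for it to
land).
ASSEMBLY: GridInjectionIdentity → GridThesis → AnomalousDissipation (≈200–300 lines: Λ-sandwich
GeneralizedLimit.le_limsup, |Λ⟨(u,ΔΦ₀)⟩| ≤ ‖ΔΦ₀‖_∞(1+E)/2, tail reindexing). DECIDING THEOREM (rev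
2, gate audit ok, unchanged): closes : GridThesis → GridInjectionIdentity → Assembly →
AnomalousDissipation := fun hX hI hA => hA hI hX. Proof chain after rev 5: BoundedEnergyNoLeakGrid +
GridSignsLaw —GridThesisGlue→ GridThesis —(GridInjectionIdentity, Assembly, closes)→
AnomalousDissipation; every arrow except the two child cruxes is provable now.
KILL CRITERIA. (1) a refuter exhibits, for EVERY transverse pattern class (cellular G at all m),
bounded-energy drift families violating c·(a) − (b) > 0 (e.g. exact "twisted-column" drift states
with Λ⟨∫w·(w·∇)Φ₀⟩ = 0 = Λ⟨(G,u)⟩ AND bounded energy as ν → 0) ⇒ close refuted:GridSigns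
(GridSignsLaw dies with it); (2) Correlation.EnergyUnboundedNeg (0204) proved ⇒ every positive route
dies; (3) DNS evidence (kit): slab-forced T³ with drift, m = 4…16, Re sweep — if d_relax → ½ and
(G,W̄) → 0 as Re grows at fixed design, retire to dormant; (4) BoundedEnergyNoLeakGrid refuted at
ONE rigid design by a 3-D Marchioro-type theorem is a misstated-class break (the thesis needs one
design): repair = the same statement over the class minus the rigid designs; refuted by a leaking LH
solution at fixed ν ⇒ re-read no-leak on regular (steady/periodic) families as route CoherentStates
does. NOT a kill: 0202 refuted for generic f.
NOT DECOMPOSED YET. The choice of G (cellular vs two-harmonic shear), slab thinness, any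
quantitative relaxation law (Taylor 1935 C_ε), the S03 kick-train line beyond KickLemma,
Fubini/slice profiles J(x₀), ρ(x₀), d_relax (the whole-torus identity avoids them); inside
BoundedEnergyNoLeakGrid the cut "regular drift families with ν-uniform energy" vs "LH families +
mean energy equality", inside GridSignsLaw the separate laws (a), (b) and the weaker load-bearing
c·(a) − (b) ≥ η — both depth-2 matters for provers' --supports lemmas, never a third layer; whether
KickLemma (no consumer in closes) stays — tenure planner.
CHEAPEST FALSIFIER. On paper: an exact bounded-energy x₀-independent ("twisted-column") drift state
for a cellular G — c e₀ plus the 2-D cellular response to the resonant slab mean G and a detuned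
bounded remainder — whose two Banach means (a) Λ⟨(G,u)⟩ and (b) Λ⟨∫⟪w,(w·∇)(ΨG)⟫⟩ both vanish while
the energy stays bounded as ν → 0: one such family per cellular pattern class kills GridSigns and
GridSignsLaw for that class (kill criterion 1). By computation: the kit DNS sweep of kill criterion
3 — d_relax → ½ together with (G,W̄) → 0 as Re grows sends the route to dormant.
PRIOR-PROGRAMME NOTES: not read (plancard mode; card-driven).
(Novelty and barriers: see the dedicated header fields of the route.)

Novelty: NOVELTY (planner plancard, 2026-08-15; builds on the card's two refuter audits of the same day,
grade new-combination, and my own searches below).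
SEARCHED (this session): crossref "energy input impulsive body force Navier-Stokes exact work
identity kicked" (no relevant hit); crossref "periodically kicked turbulence Lohse" → Lohse2000
doi:10.1103/physreve.62.4946, Hooghoudt–Lohse–Toschi 2001 doi:10.1063/1.1375146 (kicked SHELL
model), Kuczaj–Geurts–Lohse 2008 doi:10.1016/j.compfluid.2007.01.012 (periodically modulated
forcing, DNS/response), Verschoof et al. 2018 doi:10.1017/jfm.2018.276 (periodically driven
Taylor–Couette); crossref "energy injection rate deterministic forcing constant power input" →
Overholt–Pope 1998 doi:10.1016/s0045-7930(97)00019-4, Titon–Cadot 2003 doi:10.1063/1.1539856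
(injected-power statistics, experiments); crossref "Taylor hypothesis grid turbulence dissipation
constant near field non-equilibrium" → Nagata et al. 2017 doi:10.1063/1.4973416, Zheng et al. 2023
doi:10.1063/5.0161891, Vassilicos2015 (near-grid NON-equilibrium C_ε — feeds the why-might-fail of
crux #2, not prior art for the identity); zbMATH "Kolmogorov flow mean flow" → Borue–Orszag 1996
doi:10.1017/s0022112096001310 (3-D Kolmogorov flow DNS, pinned mean stress profile = the species of
the second conjunct of GridInjectionIdentity); zbMATH "periodically kicked Navier-Stokes" (0),
zbMATH "travelling wave force Galilean mean flow dissipation bound" (0); lit frontier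
AnomalousDissipation -  [refs: 10.1103/physreve.62.4946, 10.1063/1.1375146, 10.1016/j.compfluid.2007.01.012, 10.1017/jfm.2018.276, 10.1016/s0045-7930(97, 10.1063/1.1539856, 10.1063/1.4973416, 10.1063/5.0161891, 10.1017/s0022112096001310, doi:10.1103/physreve.62.4946, doi:10.1063/1.1375146, doi:10.1016/j.compfluid.2007.01.012, doi:10.1017/jfm.2018.276, doi:10.1016/s0045-7930, doi:10.1063/1.1539856, doi:10.1063/1.4973416, doi:10.]

Barriers (technique_class: impulsive-forcing galilean-drift long-time-averages): BARRIERS (catalogue Literature/Barriers/AnomalousDissipation, all files listed 2026-08-15;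
technique_class: impulsive-forcing; exact-injection-identity; galilean-drift;
energy-method-long-time-averages).
- Literature.Barriers.AnomalousDissipation.Cheskidov2023_thm13_not_forceRobustNoAnomaly
(ForceRobustEstimates): binds NO-GO arguments only. GridThesis, GridSigns, BoundedEnergyGrid are
existence statements (witness side) — not in the blocked class. The provable items
(MeanMomentumBalance, GridInjectionIdentity, KickLemma) ARE force-robust identities and accordingly
never conclude "no anomaly": consistent. A refuter attacking GridSigns by an energy-method argument
must use the exact steadiness/ν-independence of Φ·G or it proves ForceRobustNoAnomaly and
contradicts Cheskidov2023 Thm 1.3.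
- Literature.Barriers.AnomalousDissipation.Marchioro1986_globalAttraction and its audited companions
GravestModeLaminarAttractorSwept / …TimePincer (first-shell forcing is enslaved; with DRIFTING data
the swept states have bounded energy but dissipation ≤ 8να²/m₀² → 0): evaded by design twice — G is
a transverse pattern at wavenumber m ≥ 2 (cellular, two-component), never first-shell planar; and
the slab MEAN (∫Φ)G is RESONANT with the drift (k·e₀ = 0), so it is not a swept/detuned component
(those inject O(ν), consistent with sweeping-ceiling); the detuned k₀ ≠ 0 harmonics of Φ are
precisely what makes the injection impulsive. The swept barrier is quoted as the why-might-fail of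
BoundedEnergyG

Novelty grade: new-combination — NOVELTY (refuter b6c6d09e-g3, 2026-08-15). Searches this pass: zbMATH 'body-forced turbulence energy dissipation' (5: DoeringFoias2002, AlexakisDoering2006, DoeringEckhardtSchumacher2003, ChandlerKerswell2013, CheskidovDoeringPetrov2007); 'zeroth law of turbulence' (10: IyerDrivasEyink2025, BrueDeLe (refuter refuter-rreview-route-ABC-LogCardinality-b6c6d09e-g3-0, 2026-08-15T14:47:54Z; prior: ChowPakzad2022 DCDS-B 27 arXiv:2004.08655 (read p.2: stochastic forcing, E⟨ε⟩ = ½G² under energy equality — Itô free injection + no-leak = zeroth law), DoeringFoias2002 JFM 467 §2 (generalized limits, mean balances of body-forced NS), FoiasManleyRosaTemam2001 Ch. IV §3.1 (Lim T⁻¹[Φ(u(T))−Φ(u(0))] = 0 bookkeeping), DoeringEckhardtSchumacher2003 JFM 494 arXiv:nlin/0308025 (body-forced shear flow wit)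

History (route lifecycle, newest last):
- 2026-08-15T16:15:03Z · rev 3: restated BoundedEnergyGrid (stmt-AnomalousDissipation-1772) — route-repair hygiene after 5 refuter route-review passes: (1) RESTATE BoundedEnergyGrid (stmt-1772) 1:1 with the unit-mass clause (∫ x, Φ x = 1) inserted after (planner-rbadge-AnomalousDissipation-ImpulseGri-f6ad1b00-g2-0)
- 2026-08-15T16:15:03Z · rev 3: dropped BoundedEnergyEquality — route-repair hygiene after 5 refuter route-review passes: (1) RESTATE BoundedEnergyGrid (stmt-1772) 1:1 with the unit-mass clause (∫ x, Φ x = 1) inserted after (planner-rbadge-AnomalousDissipation-ImpulseGri-f6ad1b00-g2-0)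
- 2026-08-16T03:42:03Z · AUTO-CRUX (backfill): GridThesis — hypotheses of the deciding theorem that nothing in the route derives are cruxes (operator:999:586464)
- 2026-08-24T06:17:32Z · DORMANT — reconciler: no traction for 6.6 d (last activity item-evidence-added at 2026-08-17T15:53:08Z); parked, not closed — `ledger route dormant route-AnomalousDissipa (operator:999:3642333)

sub-problem: AnomalousDissipation · status: dormant · opened planner-plancard-AnomalousDissipation-Anomalo-212674b4-0 2026-08-15T10:58:35Z · rev 8 · ledger route-AnomalousDissipation-ImpulseGrid
GENERATED by the gate from the ledger (D-0016/17). Provers cite these decls: `theorem foo : Summit.AnomalousDissipation.AnomalousDissipation.Theses.ImpulseGrid.<Decl> := …` in Summits/AnomalousDissipation/AnomalousDissipation/Theorems/<Name>.lean.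
-/

namespace Summit.AnomalousDissipation.AnomalousDissipation.Theses.ImpulseGrid

open scoped BigOperators Topology Manifold Classical MeasureTheory ProbabilityTheory Matrix InnerProductSpace ComplexConjugate ContinuousMap
open Filter Set Function TopologicalSpace MeasureTheory

attribute [summit_statement] _root_.AnomalousDissipation

open Literature.Turb

/-- item stmt-AnomalousDissipation-1770 · target (kind.auto-crux: conjecture-grade) · rank 0 · open · by planner
why it might fail: Conjunction of GridSigns (#2), BoundedEnergyGrid (#3) and no-leakage (#4=0202): synchronised recoil/2-D-isation of the kicked transverse pattern, resonant slab mean laminarising with energy ∝ ν⁻², LH leakage — each open; no fixed-force example in print (Cheskidov2023 §1.2).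
sources: Lohse2000, Alvelius1999, KuksinShirikyan2012, Cheskidov2023, DoeringFoias2002, FoiasManleyRosaTemam2001
[target] Grid-in-a-wind-tunnel thesis X: slab⊗transverse steady force f = Φ(x₀)•G(x⊥) (G ⊥ e₀,
div-free, x₀-independent; Ψ the zero-mean sawtooth with ∂₀Ψ = Φ − 1, Ψ depends on x₀ only; ∫ΦΨ|G|² =
0), drift data ∫u₀ = c e₀, vanishing-viscosity global LH family with bounded mean energy (and, per
j, a sup-in-time kinetic-energy bound — automatic for ν_j > 0 by Correlation.AbsorbingBallLHTorus
0447, kept as a clause so the Assembly is self-contained), no LH leakage in the mean, and the grid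
sign conditions in one Banach mean Λ: (a) NoReversal Λ⟨(G,u_j)⟩ ≥ 0, (b) EarlyRelaxation
Λ⟨∫⟪w_j,(w_j·∇)(ΨG)⟫⟩ ≤ −η, w_j = u_j − c e₀. By GridInjectionIdentity X gives injection ≥ η/(2c)
for large j, hence the zeroth law. Intended design (not imposed): cellular G at transverse
wavenumber m ≫ 1, thin slab, M c² ≲ |G| ≪ c² (Taylor regime + imprint decays within a circuit).
Sources: idea card impulse-ito-kick-grid-no-reversal; Lohse2000; Alvelius1999; KuksinShirikyan2012;
DoeringFoias2002 §2; FoiasManleyRosaTemam2001 Ch. IV §3.1. -/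
@[route_item "route-AnomalousDissipation-ImpulseGrid"]
def GridThesis : Prop :=
  ∃ (Φ Ψ : UnitAddTorus (Fin 3) → ℝ) (G : UnitAddTorus (Fin 3) → EuclideanSpace ℝ (Fin 3)) (c η : ℝ) (Λ : Literature.Analysis.FluidPDE.GeneralizedLimit), Literature.Analysis.FunctionSpaces.Torus.IsSmooth Φ ∧ Literature.Analysis.FunctionSpaces.Torus.IsSmooth Ψ ∧ Literature.Analysis.FunctionSpaces.Torus.IsSmooth G ∧ (∀ (s : UnitAddCircle) x, Ψ (x + Pi.single (1 : Fin 3) s) = Ψ x ∧ Ψ (x + Pi.single (2 : Fin 3) s) = Ψ x) ∧ (∀ (s : UnitAddCircle) x, G (x + Pi.single (0 : Fin 3) s) = G x) ∧ (∀ x, G x 0 = 0) ∧ Literature.Analysis.FunctionSpaces.Torus.IsDivFree G ∧ (∀ x, Literature.Analysis.FunctionSpaces.Torus.partialDeriv 0 Ψ x = Φ x - 1) ∧ (∫ x, Φ x * Ψ x * ‖G x‖ ^ 2 = 0) ∧ Literature.Analysis.FunctionSpaces.Torus.IsSmooth (fun x => Φ x • G x) ∧ Literature.Analysis.FunctionSpaces.Torus.IsDivFree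 (fun x => Φ x • G x) ∧ Literature.Analysis.FunctionSpaces.Torus.HasZeroMean (fun x => Φ x • G x) ∧ 0 < c ∧ 0 < η ∧ ∃ (ν : ℕ → ℝ) (u₀ : ℕ → UnitAddTorus (Fin 3) → EuclideanSpace ℝ (Fin 3)) (u : ℕ → ℝ → UnitAddTorus (Fin 3) → EuclideanSpace ℝ (Fin 3)), (∀ j, 0 < ν j) ∧ Filter.Tendsto ν Filter.atTop (nhds 0) ∧ (∀ j, Literature.Analysis.FluidPDE.Torus.IsGlobalLerayHopf (ν j) (fun _ => fun x => Φ x • G x) (u₀ j) (u j)) ∧ (∀ j, ∃ C : ℝ, ∀ t : ℝ, 0 ≤ t → Literature.Analysis.FunctionSpaces.Torus.kineticEnergy (u j t) ≤ C) ∧ (∀ j, ∫ x, u₀ j x = c • EuclideanSpace.single 0 1) ∧ (∃ E : ℝ, ∀ j, Literature.Analysis.FluidPDE.meanEnergy (u j) ≤ E) ∧ (∀ j, Literature.Analysis.FluidPDE.longTimeAvgSup (fun t => ∫ x, inner ℝ (Φ x • G x) (u j t x)) ≤ Literature.Analysis.FluidPDE.meanDissipation (ν j) (u j)) ∧ (∀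 j, 0 ≤ Λ.longTimeAvg (fun t => ∫ x, inner ℝ (G x) (u j t x))) ∧ (∀ j, Λ.longTimeAvg (fun t => ∫ x, inner ℝ (u j t x - c • EuclideanSpace.single 0 1) (Literature.Analysis.FunctionSpaces.Torus.convect (fun y => u j t y - c • EuclideanSpace.single 0 1) (fun y => Ψ y • G y) x)) ≤ -η)

/-- item stmt-AnomalousDissipation-1771 · crux · rank 2 · open · by planner
why it might fail: Synchronised recoil: coherent transverse structures can REVERSE a smooth imprint within a circuit (2-D Euler does it exactly: Kirchhoff ellipse = perfect-recoil kicked orbit, zero net work); 2-D-isation of the kicked pattern (AlexakisDoering2006PLA); cross-moment S energy-sized off Taylor's regime.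
sources: SinhuberBodenschatzBewley2015, Vassilicos2015, doi:10.1063/1.4973416, AlexakisDoering2006PLA, Lohse2000, Literature.Barriers.AnomalousDissipation.AlexakisDoering2006_energyDissipationBound
[crux] GridThesis without the no-leakage clause: ∃ slab⊗transverse design, drift c > 0, η > 0, a
Banach mean Λ and a bounded-energy vanishing-viscosity global LH family with (a) Λ⟨(G,u_j)⟩ ≥ 0
(circuit-averaged transverse flow never anti-aligned with the kicked pattern) and (b)
Λ⟨∫⟪w_j,(w_j·∇)(ΨG)⟫⟩ ≤ −η (Reynolds-stress work against ∇G front-loaded in the first half-circuit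
behind the slab, net of the slab-vs-circuit cross-moment ∫(Φ−1)w₀(w·G)). Only c·(a) − (b) ≥ η is
load-bearing for the assembly; the split (a ≥ 0, b ≤ −η) is the physical prediction (monotone
relaxation of a grid wake; decaying-grid C_ε plateau SinhuberBodenschatzBewley2015, caveat
near-field non-equilibrium Vassilicos2015, doi:10.1063/1.4973416). Pinned normalisation:
Λ⟨∫⟪w,(w·∇)G⟫⟩ = −∫Φ|G|² − O(ν) (second conjunct of GridInjectionIdentity), so η ≤ ½∫Φ|G|² roughly.
Fastest refutation: DNS (kit) of slab-forced T³ with drift, m = 4…16, Re sweep, measuring (G,W̄),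
d_relax, S; or an exact bounded-energy drift state with both Banach means zero for every cellular G. -/
@[route_item "route-AnomalousDissipation-ImpulseGrid"]
def GridSigns : Prop :=
  ∃ (Φ Ψ : UnitAddTorus (Fin 3) → ℝ) (G : UnitAddTorus (Fin 3) → EuclideanSpace ℝ (Fin 3)) (c η : ℝ) (Λ : Literature.Analysis.FluidPDE.GeneralizedLimit), Literature.Analysis.FunctionSpaces.Torus.IsSmooth Φ ∧ Literature.Analysis.FunctionSpaces.Torus.IsSmooth Ψ ∧ Literature.Analysis.FunctionSpaces.Torus.IsSmooth G ∧ (∀ (s : UnitAddCircle) x, Ψ (x + Pi.single (1 : Fin 3) s) = Ψ x ∧ Ψ (x + Pi.single (2 : Fin 3) s) = Ψ x) ∧ (∀ (s : UnitAddCircle) x, G (x + Pi.single (0 : Fin 3) s) = G x) ∧ (∀ x, G x 0 = 0) ∧ Literature.Analysis.FunctionSpaces.Torus.IsDivFree G ∧ (∀ x, Literature.Analysis.FunctionSpaces.Torus.partialDeriv 0 Ψ x = Φ x - 1) ∧ (∫ x, Φ x * Ψ x * ‖G x‖ ^ 2 = 0) ∧ Literature.Analysis.FunctionSpaces.Torus.IsSmooth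 (fun x => Φ x • G x) ∧ Literature.Analysis.FunctionSpaces.Torus.IsDivFree (fun x => Φ x • G x) ∧ Literature.Analysis.FunctionSpaces.Torus.HasZeroMean (fun x => Φ x • G x) ∧ 0 < c ∧ 0 < η ∧ ∃ (ν : ℕ → ℝ) (u₀ : ℕ → UnitAddTorus (Fin 3) → EuclideanSpace ℝ (Fin 3)) (u : ℕ → ℝ → UnitAddTorus (Fin 3) → EuclideanSpace ℝ (Fin 3)), (∀ j, 0 < ν j) ∧ Filter.Tendsto ν Filter.atTop (nhds 0) ∧ (∀ j, Literature.Analysis.FluidPDE.Torus.IsGlobalLerayHopf (ν j) (fun _ => fun x => Φ x • G x) (u₀ j) (u j)) ∧ (∀ j, ∫ x, u₀ j x = c • EuclideanSpace.single 0 1) ∧ (∃ E : ℝ, ∀ j, Literature.Analysis.FluidPDE.meanEnergy (u j) ≤ E) ∧ (∀ j, 0 ≤ Λ.longTimeAvg (fun t => ∫ x, inner ℝ (G x) (u j t x))) ∧ (∀ j, Λ.longTimeAvg (fun t => ∫ x, inner ℝ (u j t x - c • EuclideanSpace.single 0 1) (Literature.Analysis.FunctionSpaces.Torus.convect (fun y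 => u j t y - c • EuclideanSpace.single 0 1) (fun y => Ψ y • G y) x)) ≤ -η)

-- earlier BoundedEnergyGrid (stmt-AnomalousDissipation-1772, replaced 2026-08-15T16:15:03Z -> stmt-AnomalousDissipation-10430): retired by None — ∃ (Φ : UnitAddTorus (Fin 3) → ℝ) (G : UnitAddTorus (Fin 3) → EuclideanSpace ℝ (Fin 3)) (c : ℝ), Literature.Analysis.FunctionSpaces.Torus.IsSmooth Φ ∧ Literature.Analysis.FunctionSpaces.Torus.IsSmooth G ∧ (∀ (s : UnitAddCircle) x, Φ (x + Pi.single (1 : Fin 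
/-- item stmt-AnomalousDissipation-10430 · crux · rank 3 · open · by planner
why it might fail: No ν-uniform energy bound is known for ANY fixed f ≠ 0 in 3-D (FMRT (13.11): ∝ ν⁻²); with ∫Φ = 1 the slab mean G is resonant (k₀ = 0, not Doppler-detuned) and its laminar branch c e₀ + G-response has energy ∝ ν⁻²; 2-D-isation/condensation of the transverse pattern would also blow the bound.
sources: FoiasManleyRosaTemam2001, DoeringFoias2002, Cheskidov2023, Literature.Barriers.AnomalousDissipation.Marchioro1986_globalAttraction
[crux] RESTATED 2026-08-15 (route-repair; refuter objection on stmt-AnomalousDissipation-1772 by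
384b3dc6 / 1241901e / b6c6d09e / b6c6d09e-g2: without a unit-mass normalisation of Φ the statement
is witnessed by the Galilean-DETUNED laminar swept state Φ = cos 2πx₀, G = sin(2πx₁)e₂, u = c e₀ +
A(x₀) sin(2πx₁) e₂ — bounded energy, O(ν) dissipation, zero content; fix applied = insert `(∫ x, Φ x
= 1)`). A nontrivial slab⊗transverse force f = Φ(x₀)•G(x⊥) (Φ depends on x₀ only and has UNIT MASS
∫Φ = 1 — the torus measure is a probability measure, so this is the x₀-mean of Φ, exactly what
GridThesis/GridSigns enforce through the sawtooth Ψ with ∂₀Ψ = Φ − 1; G ⊥ e₀ and x₀-independent; f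
smooth, div-free, mean-zero, f ≠ 0) with through-flow data ∫u₀ = c e₀, c > 0, admits a
vanishing-viscosity global Leray–Hopf family with bounded limsup-mean energy. With ∫Φ = 1 the slab
mean (∫Φ)G = G is RESONANT with the drift (k₀ = 0, not Doppler-shifted), so every x₀-independent /
laminar response has energy ∝ ν⁻² (shear or cellular Stokes-eigenfield G: u = c e₀ + G/(νλ) +
detuned bounded part) and bounded energy forces 3-D breakdown of the kicked pattern every circuit —
the free-decay zeroth law in dis -/
@[route_item "route-AnomalousDissipation-ImpulseGrid"]
def BoundedEnergyGrid : Prop :=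
  ∃ (Φ : UnitAddTorus (Fin 3) → ℝ) (G : UnitAddTorus (Fin 3) → EuclideanSpace ℝ (Fin 3)) (c : ℝ), Literature.Analysis.FunctionSpaces.Torus.IsSmooth Φ ∧ Literature.Analysis.FunctionSpaces.Torus.IsSmooth G ∧ (∀ (s : UnitAddCircle) x, Φ (x + Pi.single (1 : Fin 3) s) = Φ x ∧ Φ (x + Pi.single (2 : Fin 3) s) = Φ x) ∧ (∫ x, Φ x = 1) ∧ (∀ (s : UnitAddCircle) x, G (x + Pi.single (0 : Fin 3) s) = G x) ∧ (∀ x, G x 0 = 0) ∧ Literature.Analysis.FunctionSpaces.Torus.IsSmooth (fun x => Φ x • G x) ∧ Literature.Analysis.FunctionSpaces.Torus.IsDivFree (fun x => Φ x • G x) ∧ Literature.Analysis.FunctionSpaces.Torus.HasZeroMean (fun x => Φ x • G x) ∧ (fun x => Φ x • G x) ≠ 0 ∧ 0 < c ∧ ∃ (ν : ℕ → ℝ) (u₀ : ℕ → UnitAddTorus (Fin 3) → EuclideanSpace ℝ (Fin 3)) (u : ℕ → ℝ → UnitAddTorus (Fin 3) → EuclideanSpace ℝ (Fin 3)), (∀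 j, 0 < ν j) ∧ Filter.Tendsto ν Filter.atTop (nhds 0) ∧ (∀ j, Literature.Analysis.FluidPDE.Torus.IsGlobalLerayHopf (ν j) (fun _ => fun x => Φ x • G x) (u₀ j) (u j)) ∧ (∀ j, ∫ x, u₀ j x = c • EuclideanSpace.single 0 1) ∧ ∃ E : ℝ, ∀ j, Literature.Analysis.FluidPDE.meanEnergy (u j) ≤ E

/-- item stmt-AnomalousDissipation-14349 · crux · rank 4 · open · by planner
why it might fail: A law for ALL bounded-energy drift families of one design: a phase-locked coherent wake could reverse the imprint (Kirchhoff-ellipse recoil; 2-D-isation, AlexakisDoering2006PLA) even if generic grid wakes relax monotonically; η uniform in j ≥ J may fail; vacuity needs an unknown 3-D Marchioro thm.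
sources: SinhuberBodenschatzBewley2015, Vassilicos2015, doi:10.1063/1.4973416, AlexakisDoering2006PLA, Lohse2000, BorueOrszag1996
[crux] THE GRID SIGN LAW (proof-path child of GridThesis together with BoundedEnergyNoLeakGrid; the
glue BoundedEnergyNoLeakGrid → GridSignsLaw → GridThesis is certified in the planner's Sketch.lean,
lean check rc 0, 0 sorries). ∃ design — unit-mass slab profile Φ(x₀) (∫Φ = 1, x⊥-invariant), its
zero-mean sawtooth Ψ (∂₀Ψ = Φ − 1, ∫ΦΨ|G|² = 0), a smooth transverse x₀-independent divergence-free
pattern G ⊥ e₀, drift c > 0, f = Φ•G smooth/div-free/mean-zero (the design clauses of GridThesis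
plus the two Φ-clauses of BoundedEnergyGrid, so that both children speak of the same class) — such
that for EVERY vanishing-viscosity global Leray–Hopf family forced by f with drift data ∫u₀ⱼ = c e₀,
per-j sup-in-time energy bounds and meanEnergy(uⱼ) ≤ E there are η > 0, one Banach mean Λ and a
threshold J with, for all j ≥ J: (a) NO REVERSAL 0 ≤ Λ⟨(G,uⱼ)⟩ and (b) EARLY RELAXATION
Λ⟨∫⟪wⱼ,(wⱼ·∇)(ΨG)⟫⟩ ≤ −η, wⱼ = uⱼ − c e₀. This is the route's physical bet in its natural universal
form (a statement about all finite-energy wakes of the grid, not about one hand-picked family);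
GridSignsLaw ∧ (a bounded-energy drift family of that design) ⇒ GridSigns (#2). 'Eventually in j'
because viscous members (lar -/
@[route_item "route-AnomalousDissipation-ImpulseGrid", crux]
def GridSignsLaw : Prop :=
  ∃ (Φ Ψ : UnitAddTorus (Fin 3) → ℝ) (G : UnitAddTorus (Fin 3) → EuclideanSpace ℝ (Fin 3)) (c : ℝ), Literature.Analysis.FunctionSpaces.Torus.IsSmooth Φ ∧ Literature.Analysis.FunctionSpaces.Torus.IsSmooth Ψ ∧ Literature.Analysis.FunctionSpaces.Torus.IsSmooth G ∧ (∀ (s : UnitAddCircle) x, Φ (x + Pi.single (1 : Fin 3) s) = Φ x ∧ Φ (x + Pi.single (2 : Fin 3) s) = Φ x) ∧ (∫ x, Φ x = 1) ∧ (∀ (s : UnitAddCircle) x, Ψ (x + Pi.single (1 : Fin 3) s) = Ψ x ∧ Ψ (x + Pi.single (2 : Fin 3) s) = Ψ x) ∧ (∀ (s : UnitAddCircle) x, G (x + Pi.single (0 : Fin 3) s) = G x) ∧ (∀ x, G x 0 = 0) ∧ Literature.Analysis.FunctionSpaces.Torus.IsDivFree G ∧ (∀ x, Literature.Analysis.FunctionSpaces.Torus.partialDeriv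 0 Ψ x = Φ x - 1) ∧ (∫ x, Φ x * Ψ x * ‖G x‖ ^ 2 = 0) ∧ Literature.Analysis.FunctionSpaces.Torus.IsSmooth (fun x => Φ x • G x) ∧ Literature.Analysis.FunctionSpaces.Torus.IsDivFree (fun x => Φ x • G x) ∧ Literature.Analysis.FunctionSpaces.Torus.HasZeroMean (fun x => Φ x • G x) ∧ 0 < c ∧ ∀ (ν : ℕ → ℝ) (u₀ : ℕ → UnitAddTorus (Fin 3) → EuclideanSpace ℝ (Fin 3)) (u : ℕ → ℝ → UnitAddTorus (Fin 3) → EuclideanSpace ℝ (Fin 3)) (E : ℝ), (∀ j, 0 < ν j) → Filter.Tendsto ν Filter.atTop (nhds 0) → (∀ j, Literature.Analysis.FluidPDE.Torus.IsGlobalLerayHopf (ν j) (fun _ => fun x => Φ x • G x) (u₀ j) (u j)) → (∀ j, ∃ C : ℝ, ∀ t : ℝ, 0 ≤ t → Literature.Analysis.FunctionSpaces.Torus.kineticEnergy (u j t) ≤ C) → (∀ j, ∫ x, u₀ j x = c • EuclideanSpace.single 0 1) → (∀ j, Literature.Analysis.FluidPDE.meanEnergy (u j) ≤ E) → ∃ η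 : ℝ, 0 < η ∧ ∃ (Λ : Literature.Analysis.FluidPDE.GeneralizedLimit) (J : ℕ), ∀ j, J ≤ j → 0 ≤ Λ.longTimeAvg (fun t => ∫ x, inner ℝ (G x) (u j t x)) ∧ Λ.longTimeAvg (fun t => ∫ x, inner ℝ (u j t x - c • EuclideanSpace.single 0 1) (Literature.Analysis.FunctionSpaces.Torus.convect (fun y => u j t y - c • EuclideanSpace.single 0 1) (fun y => Ψ y • G y) x)) ≤ -η

/-- item stmt-AnomalousDissipation-14350 · crux · rank 5 · open · by planner
why it might fail: No ν-uniform energy bound is known for any fixed f ≠ 0 in 3-D (FMRT (13.11): ∝ ν⁻²); mean energy equality for Leray–Hopf is open (FMRT p.71; CCFS2008 classes only) while regular (steady/periodic) families lack ν-uniform energy bounds; ∀-design dies on any 3-D Marchioro-type laminar attractor.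
sources: FoiasManleyRosaTemam2001, DoeringFoias2002, Cheskidov2023, CheskidovConstantinFriedlanderShvydkoy2008, BuckmasterVicol2019Annals, BorueOrszag1996
[crux] EXISTENCE SIDE (proof-path child of GridThesis together with GridSignsLaw). For EVERY grid
design — Φ smooth, x⊥-invariant, unit mass ∫Φ = 1; G smooth, x₀-invariant, G ⊥ e₀; f = Φ•G smooth,
divergence-free, mean-zero; drift c > 0 (exactly the clause list of BoundedEnergyGrid (#3) minus f ≠
0, universally quantified) — there is a vanishing-viscosity family of global Leray–Hopf solutions
with drift data ∫u₀ⱼ = c e₀, per-j sup-in-time kinetic-energy bounds (automatic at νⱼ > 0: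
Correlation.AbsorbingBallLHTorus, stmt-AnomalousDissipation-0447), ν-uniformly bounded limsup-mean
energy, AND no Leray–Hopf leakage in the mean, ⟨(f,uⱼ)⟩ ≤ νⱼ⟨‖∇uⱼ‖²⟩ (mean energy equality; the
reverse inequality is the Leray–Hopf energy inequality, Correlation.MeanEnergyInequalityZeroMean,
stmt-AnomalousDissipation-0446). Two difficulties, deliberately on ONE family: (i) a ν-uniform
energy bound at fixed force (open for every f ≠ 0 in 3-D; turbulent saturation Re ~ Gr^{1/2} instead
of laminar Re ~ Gr, DoeringFoias2002 §3; here every x₀-independent/laminar response has energy ∝ ν⁻²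
because the unit-mass slab mean G is resonant with the drift) and (ii) mean energy equality of the
chosen solutions — free -/
@[route_item "route-AnomalousDissipation-ImpulseGrid", crux]
def BoundedEnergyNoLeakGrid : Prop :=
  ∀ (Φ : UnitAddTorus (Fin 3) → ℝ) (G : UnitAddTorus (Fin 3) → EuclideanSpace ℝ (Fin 3)) (c : ℝ), Literature.Analysis.FunctionSpaces.Torus.IsSmooth Φ → Literature.Analysis.FunctionSpaces.Torus.IsSmooth G → (∀ (s : UnitAddCircle) x, Φ (x + Pi.single (1 : Fin 3) s) = Φ x ∧ Φ (x + Pi.single (2 : Fin 3) s) = Φ x) → (∫ x, Φ x = 1) → (∀ (s : UnitAddCircle) x, G (x + Pi.single (0 : Fin 3) s) = G x) → (∀ x, G x 0 = 0) → Literature.Analysis.FunctionSpaces.Torus.IsSmooth (fun x => Φ x • G x) → Literature.Analysis.FunctionSpaces.Torus.IsDivFree (fun x => Φ x • G x) → Literature.Analysis.FunctionSpaces.Torus.HasZeroMean (fun x => Φ x • G x) → 0 < c → ∃ (ν : ℕ → ℝ) (u₀ : ℕ → UnitAddTorus (Fin 3) → EuclideanSpace ℝ (Fin 3)) (u : ℕ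 → ℝ → UnitAddTorus (Fin 3) → EuclideanSpace ℝ (Fin 3)), (∀ j, 0 < ν j) ∧ Filter.Tendsto ν Filter.atTop (nhds 0) ∧ (∀ j, Literature.Analysis.FluidPDE.Torus.IsGlobalLerayHopf (ν j) (fun _ => fun x => Φ x • G x) (u₀ j) (u j)) ∧ (∀ j, ∃ C : ℝ, ∀ t : ℝ, 0 ≤ t → Literature.Analysis.FunctionSpaces.Torus.kineticEnergy (u j t) ≤ C) ∧ (∀ j, ∫ x, u₀ j x = c • EuclideanSpace.single 0 1) ∧ (∃ E : ℝ, ∀ j, Literature.Analysis.FluidPDE.meanEnergy (u j) ≤ E) ∧ (∀ j, Literature.Analysis.FluidPDE.longTimeAvgSup (fun t => ∫ x, inner ℝ (Φ x • G x) (u j t x)) ≤ Literature.Analysis.FluidPDE.meanDissipation (ν j) (u j))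

/-- item stmt-AnomalousDissipation-18236 · crux · rank 6 · open · by planner
why it might fail: A ν-uniform SIGN law for every bounded-energy wake of one explicit force: (x₀,t)↦(−x₀,−t) makes DC/AC odd, so a proof must pull an O(1) sign out of ν×gradients; a phase-locked transverse condensate could reverse DC (2-D-isation); the AC floor may fade as ν→0 (DNS: W_AC/inj = 4–14 % only).
sources: AlexakisDoering2006PLA, BorueOrszag1996, Cheskidov2023, DoeringFoias2002, Vassilicos2015, doi:10.1103/physrevlett.104.184506
[crux] CHILD 1 of GridThesis (AC/DC split = BC2 redirect of the RESTATED deciding crux,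
crux-strategist 2026-08-17). THE FIRST-MOMENT SIGN LAW OF THE EXPLICIT AC/DC GRID (∃ parameters, ∀
families): for some mesh m ≥ 1, pattern amplitude A > 0, AC depth θ > 0 and drift c > 0, with Φ = 1
+ 2θ cos 2πx₀ and G = A[sin 2πm(x₁+x₂)(e₁−e₂) + sin 2πm(x₁−x₂)(e₁+e₂)] (cellular two-mode Stokes
pattern, ΔG = −8π²m²G, G ⊥ e₀, x₀-independent), EVERY vanishing-viscosity global Leray–Hopf family
forced by Φ•G with drift data ∫u₀ⱼ = c e₀, per-j sup-energy bounds and meanEnergy ≤ E admits κ > 0,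
one generalized limit Λ and a threshold J with, for j ≥ J, (DC) 0 ≤ Λ⟨(G,u_j)⟩ — the circuit-mean
imprint is not reversed — and (AC) κ ≤ Λ⟨((Φ−1)•G,u_j)⟩ = 2θΛ⟨(cos(2πx₀)G,u_j)⟩ — the imprint is
larger at the slab than on circuit average. VERBATIM the registered physics stub
`stub_firstMomentLawACDC` of the GridSignsLaw line (Cruxes/GridSignsLaw/Lines/Sketch.lean; by
`GridSignsLaw_of` there it implies GridSignsLaw stmt-14349), and the ∀-family form of the GridThesis
line's eddy-drag stub (`stub_dragFamilyForAcdcGrid`; AC/DC eddy drag ⇒ these signs by the landed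
stub_alphaBalance / stub_acWorkOfQuadratureDrag / -/
@[route_item "route-AnomalousDissipation-ImpulseGrid", crux]
def AcdcFirstMomentLaw : Prop :=
  ∃ (m : ℕ) (A θ c : ℝ), 1 ≤ m ∧ 0 < A ∧ 0 < θ ∧ 0 < c ∧ ∀ (Φ : UnitAddTorus (Fin 3) → ℝ) (G : UnitAddTorus (Fin 3) → EuclideanSpace ℝ (Fin 3)), Φ = (fun x => 1 + 2 * θ * (UnitAddTorus.mFourier (Pi.single (0 : Fin 3) (1 : ℤ)) x).re) → G = (fun x => A • (Literature.Analysis.FluidPDE.Torus.stokesMode ![(0 : ℤ), (m : ℤ), (m : ℤ)] (EuclideanSpace.single (1 : Fin 3) (1 : ℝ) - EuclideanSpace.single (2 : Fin 3) (1 : ℝ)) false x + Literature.Analysis.FluidPDE.Torus.stokesMode ![(0 : ℤ), (m : ℤ), -(m : ℤ)] (EuclideanSpace.single (1 : Fin 3) (1 : ℝ) + EuclideanSpace.single (2 : Fin 3) (1 : ℝ)) false x)) → ∀ (ν : ℕ → ℝ) (u₀ : ℕ → UnitAddTorus (Fin 3) → EuclideanSpace ℝ (Fin 3)) (u : ℕ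 → ℝ → UnitAddTorus (Fin 3) → EuclideanSpace ℝ (Fin 3)) (E : ℝ), (∀ j, 0 < ν j) → Filter.Tendsto ν Filter.atTop (nhds 0) → (∀ j, Literature.Analysis.FluidPDE.Torus.IsGlobalLerayHopf (ν j) (fun _ => fun x => Φ x • G x) (u₀ j) (u j)) → (∀ j, ∃ C : ℝ, ∀ t : ℝ, 0 ≤ t → Literature.Analysis.FunctionSpaces.Torus.kineticEnergy (u j t) ≤ C) → (∀ j, ∫ x, u₀ j x = c • EuclideanSpace.single 0 1) → (∀ j, Literature.Analysis.FluidPDE.meanEnergy (u j) ≤ E) → ∃ κ : ℝ, 0 < κ ∧ ∃ (Λ : Literature.Analysis.FluidPDE.GeneralizedLimit) (J : ℕ), ∀ j, J ≤ j → 0 ≤ Λ.longTimeAvg (fun t => ∫ x, inner ℝ (G x) (u j t x)) ∧ κ ≤ Λ.longTimeAvg (fun t => ∫ x, inner ℝ ((Φ x - 1) • G x) (u j t x))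

/-- item stmt-AnomalousDissipation-18237 · crux · rank 7 · open · by planner
why it might fail: ν-uniform mean energy at a FIXED force is open in 3-D for every f ≠ 0 (FMRT (13.11): laminar ∝ ν⁻²; the unit-mass slab mean G is drift-resonant); Leray–Hopf mean energy equality is open as a law (FMRT p.71); ∀(m,A,θ,c) dies on one laminar global attractor (none known in 3-D).
sources: FoiasManleyRosaTemam2001, DoeringFoias2002, CheskidovConstantinFriedlanderShvydkoy2008, Cheskidov2023, Literature.Barriers.AnomalousDissipation.Marchioro1986_globalAttraction
[crux] CHILD 2 of GridThesis (AC/DC split = BC2 redirect, crux-strategist 2026-08-17).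
BOUNDED-ENERGY NO-LEAK DRIFT FAMILIES FOR THE EXPLICIT AC/DC GRID (∀ parameters, ∃ family): for all
m ≥ 1, A, θ, c > 0, the force Φ•G (Φ = 1 + 2θ cos 2πx₀, G the cellular two-mode Stokes pattern at
transverse wavenumber (m, ±m)) admits viscosities ν_j → 0⁺, drift data ∫u₀ⱼ = c e₀ and global
Leray–Hopf solutions u_j with j-UNIFORMLY bounded limsup-mean energy and NO Leray–Hopf LEAKAGE in
the mean, ⟨(Φ•G,u_j)⟩ ≤ ν_j⟨‖∇u_j‖²⟩ (mean energy equality; the reverse inequality is the energy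
inequality). The AC/DC specialisation of BoundedEnergyNoLeakGrid (stmt-14350 ⇒ this, by
stub_acdcGridAdmissible p112659) minus its per-j sup-energy clause (automatic at ν_j > 0, derived in
the assembly from IsGlobalLerayHopf.exists_forall_integral_norm_sq_le_of_hasZeroMean). It lies
OUTSIDE the landed hardness pins of stmt-14350 (p118293/p119194 live at Φ ≡ 1 with a shear pattern;
here θ > 0 and G is cellular, and in the drift frame the force is the steady cellular G plus a SWEPT
AC part, not a steady columnar force), but it is existence of the same open kind: turbulent
saturation Re ~ Gr^{1/2} at a fixed force (Doerin -/
@[route_item "route-AnomalousDissipation-ImpulseGrid", crux]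
def AcdcEnergyNoLeak : Prop :=
  ∀ (m : ℕ) (A θ c : ℝ), 1 ≤ m → 0 < A → 0 < θ → 0 < c → ∀ (Φ : UnitAddTorus (Fin 3) → ℝ) (G : UnitAddTorus (Fin 3) → EuclideanSpace ℝ (Fin 3)), Φ = (fun x => 1 + 2 * θ * (UnitAddTorus.mFourier (Pi.single (0 : Fin 3) (1 : ℤ)) x).re) → G = (fun x => A • (Literature.Analysis.FluidPDE.Torus.stokesMode ![(0 : ℤ), (m : ℤ), (m : ℤ)] (EuclideanSpace.single (1 : Fin 3) (1 : ℝ) - EuclideanSpace.single (2 : Fin 3) (1 : ℝ)) false x + Literature.Analysis.FluidPDE.Torus.stokesMode ![(0 : ℤ), (m : ℤ), -(m : ℤ)] (EuclideanSpace.single (1 : Fin 3) (1 : ℝ) + EuclideanSpace.single (2 : Fin 3) (1 : ℝ)) false x)) → ∃ (ν : ℕ → ℝ) (u₀ : ℕ → UnitAddTorus (Fin 3) → EuclideanSpace ℝ (Fin 3)) (u : ℕ → ℝ → UnitAddTorus (Fin 3) → EuclideanSpace ℝ (Fin 3)), (∀ j, 0 < ν j) ∧ Filter.Tendsto ν Filter.atTop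 (nhds 0) ∧ (∀ j, Literature.Analysis.FluidPDE.Torus.IsGlobalLerayHopf (ν j) (fun _ => fun x => Φ x • G x) (u₀ j) (u j)) ∧ (∀ j, ∫ x, u₀ j x = c • EuclideanSpace.single 0 1) ∧ (∃ E : ℝ, ∀ j, Literature.Analysis.FluidPDE.meanEnergy (u j) ≤ E) ∧ (∀ j, Literature.Analysis.FluidPDE.longTimeAvgSup (fun t => ∫ x, inner ℝ (Φ x • G x) (u j t x)) ≤ Literature.Analysis.FluidPDE.meanDissipation (ν j) (u j))

/-- item stmt-AnomalousDissipation-14351 · support · rank 9 · closed · proved by Summit.AnomalousDissipation.AnomalousDissipation.Theorems.gridThesisGlue_proof (prover) · by planner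
sources: DoeringFoias2002
[support] [glue] BoundedEnergyNoLeakGrid → GridSignsLaw → GridThesis: the proof-path glue that makes
the target reachable (route-choice repair 2026-08-16, operator hold target-unreachable). Pure logic
+ tail shift, PROVED in the planner's Sketch.lean (theorem gridThesis_of_split, lean check rc 0, 0
sorries, ~20 lines; attached as evidence on this item): take the design (Φ,Ψ,G,c) from GridSignsLaw,
the family (ν,u₀,u) and its energy bound E from BoundedEnergyNoLeakGrid at that design (its
hypotheses are a sub-list of the law's design clauses), then (η,Λ,J) from the law applied to that
family, and reindex j ↦ j+J (Filter.tendsto_add_atTop_iff_nat keeps ν → 0; every other clause of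
GridThesis is a pointwise-in-j hypothesis instance). Landable verbatim as
Summits/AnomalousDissipation/AnomalousDissipation/Theorems/<Name>.lean. [deps:
BoundedEnergyNoLeakGrid, GridSignsLaw, GridThesis] [difficulty: S] -/
@[route_item "route-AnomalousDissipation-ImpulseGrid"]
def GridThesisGlue : Prop :=
  BoundedEnergyNoLeakGrid → GridSignsLaw → GridThesis

/-- item stmt-AnomalousDissipation-1773 · support · rank 9 · closed · proved by Summit.AnomalousDissipation.AnomalousDissipation.Theorems.meanMomentumBalance_proof (prover) · by planner
sources: FoiasManleyRosaTemam2001, DoeringFoias2002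
[support] Provable now (~250–400 lines). Mean momentum balance of a global LH solution (steady
smooth force, ν > 0, sup-in-time kinetic energy bounded) tested against a smooth steady
divergence-free field Φ₀, in a generalized (Banach) long-time limit Λ: Λ⟨∫⟪u,(u·∇)Φ₀⟫⟩ +
νΛ⟨∫⟪u,ΔΦ₀⟫⟩ + ∫⟪f,Φ₀⟫ = 0. Plan: weak formulation (Torus.IsWeakNSSolutionForcedOn.weak) with ψ =
χ(t)Φ₀(x), χ a smooth cutoff of [0,T]; weak continuity (IsLerayHopfOn.weak_continuous) to sharpen:
(u(T),Φ₀) − (u₀,Φ₀) = ∫₀ᵀ[...]dt for all T > 0; the three integrands are measurable and bounded on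
[0,T] (|∫⟪u,(u·∇)Φ₀⟫| ≤ ‖∇Φ₀‖_∞∫|u|²), so timeMean is additive; divide by T, the left side → 0 by
the sup-energy hypothesis, Λ linear and = lim on convergent functions
(GeneralizedLimit.apply_eq_of_tendsto). Known technique: FoiasManleyRosaTemam2001 Ch. IV §3.1 (PDF
pp.208–210: Lim T⁻¹[Φ(u(T)) − Φ(u(0))] = 0). Reusable by the crossflow/Ważewski/dual-budget cards.
The sup-energy hypothesis is discharged for ν > 0, mean-zero f by Correlation.AbsorbingBallLHTorus
(stmt-AnomalousDissipation-0447). -/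
@[route_item "route-AnomalousDissipation-ImpulseGrid"]
def MeanMomentumBalance : Prop :=
  ∀ (Λ : Literature.Analysis.FluidPDE.GeneralizedLimit) (ν : ℝ) (f Φ₀ : UnitAddTorus (Fin 3) → EuclideanSpace ℝ (Fin 3)) (u₀ : UnitAddTorus (Fin 3) → EuclideanSpace ℝ (Fin 3)) (u : ℝ → UnitAddTorus (Fin 3) → EuclideanSpace ℝ (Fin 3)), 0 < ν → Literature.Analysis.FunctionSpaces.Torus.IsSmooth f → Literature.Analysis.FunctionSpaces.Torus.IsSmooth Φ₀ → Literature.Analysis.FunctionSpaces.Torus.IsDivFree Φ₀ → Literature.Analysis.FluidPDE.Torus.IsGlobalLerayHopf ν (fun _ => f) u₀ u → (∃ C : ℝ, ∀ t : ℝ, 0 ≤ t → Literature.Analysis.FunctionSpaces.Torus.kineticEnergy (u t) ≤ C) → Λ.longTimeAvg (fun t => ∫ x, inner ℝ (u t x) (Literature.Analysis.FunctionSpaces.Torus.convect (u t) Φ₀ x)) + ν * Λ.longTimeAvg (fun t => ∫ x, inner ℝ (u t x) (Literature.Analysis.FunctionSpaces.Torus.laplacian Φ₀ x)) + ∫ x,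 inner ℝ (f x) (Φ₀ x) = 0

/-- item stmt-AnomalousDissipation-1774 · support · rank 9 · closed · proved by Summit.AnomalousDissipation.AnomalousDissipation.Theorems.impulseGrid_gridInjectionIdentity @ 96458fa645b9 (prover) · by planner
sources: FoiasManleyRosaTemam2001, Lohse2000, Alvelius1999
[support] Provable now from MeanMomentumBalance + pointwise algebra (~200 lines). For the
slab⊗transverse force Φ•G (G smooth, ⊥ e₀, x₀-invariant, div-free; Ψ smooth, depends on x₀ only, ∂₀Ψ
= Φ − 1), ANY constant c, w := u − c e₀, and a global LH solution with sup-in-time energy bound: (1)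
the sawtooth identity c·Λ⟨(Φ•G,u)⟩ = c·Λ⟨(G,u)⟩ − Λ⟨∫⟪w,(w·∇)(Ψ•G)⟫⟩ − νΛ⟨(u,Δ(Ψ•G))⟩ − ∫ΦΨ|G|²; (2)
the pinned transverse stress Λ⟨∫⟪w,(w·∇)G⟫⟩ = −∫Φ|G|² − νΛ⟨(u,ΔG)⟩ (the force feeds the G-projection
of momentum at the state-independent rate ∫Φ|G|² — Itô's free injection without noise). Key algebra
(checked by hand): ⟪u,(u·∇)(ΨG)⟫ = c·∂₀Ψ·⟪w,G⟫ + ⟪w,(w·∇)(ΨG)⟫ because G₀ = 0 kills ⟪e₀,·⟫ and ∂₀G =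
0; div(Ψ•G) = 0 so Ψ•G and G are admissible tests; Φ⟪G,u⟫ = ⟪Φ•G,u⟫. Needs linearity of
Λ.longTimeAvg on the (integrable, bounded) pieces. No Fubini/slices needed. The sup-energy
hypothesis is discharged for ν > 0, mean-zero f by Correlation.AbsorbingBallLHTorus
(stmt-AnomalousDissipation-0447). -/
@[route_item "route-AnomalousDissipation-ImpulseGrid", crux]
def GridInjectionIdentity : Prop :=
  ∀ (Λ : Literature.Analysis.FluidPDE.GeneralizedLimit) (ν c : ℝ) (Φ Ψ : UnitAddTorus (Fin 3) → ℝ) (G : UnitAddTorus (Fin 3) → EuclideanSpace ℝ (Fin 3)) (u₀ : UnitAddTorus (Fin 3) → EuclideanSpace ℝ (Fin 3)) (u : ℝ → UnitAddTorus (Fin 3) → EuclideanSpace ℝ (Fin 3)), 0 < ν → Literature.Analysis.FunctionSpaces.Torus.IsSmooth Φ → Literature.Analysis.FunctionSpaces.Torus.IsSmooth Ψ → Literature.Analysis.FunctionSpaces.Torus.IsSmooth G → (∀ (s : UnitAddCircle) x, Ψ (x + Pi.single (1 : Fin 3) s) = Ψ x ∧ Ψ (x + Pi.single (2 : Fin 3)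 s) = Ψ x) → (∀ (s : UnitAddCircle) x, G (x + Pi.single (0 : Fin 3) s) = G x) → (∀ x, G x 0 = 0) → Literature.Analysis.FunctionSpaces.Torus.IsDivFree G → (∀ x, Literature.Analysis.FunctionSpaces.Torus.partialDeriv 0 Ψ x = Φ x - 1) → Literature.Analysis.FluidPDE.Torus.IsGlobalLerayHopf ν (fun _ => fun x => Φ x • G x) u₀ u → (∃ C : ℝ, ∀ t : ℝ, 0 ≤ t → Literature.Analysis.FunctionSpaces.Torus.kineticEnergy (u t) ≤ C) → c * Λ.longTimeAvg (fun t => ∫ x, inner ℝ (Φ x • G x) (u t x)) = c * Λ.longTimeAvg (fun t => ∫ x, inner ℝ (G x) (u t x)) - Λ.longTimeAvg (fun t => ∫ x, inner ℝ (u t x - c • EuclideanSpace.single 0 1) (Literature.Analysis.FunctionSpaces.Torus.convect (fun y => u t y - c • EuclideanSpace.single 0 1) (fun y => Ψ y • G y) x)) - ν * Λ.longTimeAvg (fun t => ∫ x, inner ℝ (u t x) (Literature.Analysis.FunctionSpaces.Torus.laplacian (fun y => Ψ y • G y) x)) - ∫ x, Φ x * Ψ x * ‖G x‖ ^ 2 ∧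 Λ.longTimeAvg (fun t => ∫ x, inner ℝ (u t x - c • EuclideanSpace.single 0 1) (Literature.Analysis.FunctionSpaces.Torus.convect (fun y => u t y - c • EuclideanSpace.single 0 1) G x)) = -(∫ x, Φ x * ‖G x‖ ^ 2) - ν * Λ.longTimeAvg (fun t => ∫ x, inner ℝ (u t x) (Literature.Analysis.FunctionSpaces.Torus.laplacian G x))

/-- item stmt-AnomalousDissipation-1775 · support · rank 9 · closed · proved by Summit.AnomalousDissipation.AnomalousDissipation.Theorems.kickLemma_proof (prover) · by planner
sources: KuksinShirikyan2012, KuksinPenrose2005, Alvelius1999, Lohse2000, Novikov1965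
[support] NOT in the Assembly — the time-domain twin (kick trains φ(t mod T)•g(x), φ ≥ 0 smooth
supported in (0,δ), ∫φ = 1, δ < T) of the route's mechanism, provable now in the LH energy class
(~300 lines) and the one-sided reduction of the registered OPEN S03 =
Literature.Analysis.FluidPDE.ZerothLawTimePeriodic to NoReversal + bounded energy + no leakage (card
§K; refuter audit asked for it to land). Statement: ∀ smooth div-free g ∃ K ∀ (ν ≤ 1, T, δ, φ, LH
solution u with kineticEnergy(u t) ≤ E for t ≥ 0, n ≥ 1): |W_n − ½‖g‖² − (g,u(nT))| ≤ K(1+E)δ, W_n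
:= ∫_{nT}^{nT+δ} φ(t−nT)(g,u(t))dt the work of kick n. Proof: weak form tested with χ(t)g(x):
(g,u(t)) = (g,u(nT)) + ‖g‖²∫_{nT}^t φ + ∫_{nT}^t[(u,(u·∇)g) + ν(u,Δg)], the bracket ≤ 2‖∇g‖_∞E +
ν‖Δg‖₂(2E)^{1/2}; multiply by φ(t−nT), integrate, ∫φ·Φ = ½ exactly (Φ = ∫φ); K = 2‖∇g‖_∞ + ‖Δg‖₂.
ν-uniform because δ is a free design parameter. Deterministic counterpart of the random-kick balance
(KuksinShirikyan2012 §2; KuksinPenrose2005) and of Alvelius1999's forcing design. -/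
@[route_item "route-AnomalousDissipation-ImpulseGrid"]
def KickLemma : Prop :=
  ∀ (g : UnitAddTorus (Fin 3) → EuclideanSpace ℝ (Fin 3)), Literature.Analysis.FunctionSpaces.Torus.IsSmooth g → Literature.Analysis.FunctionSpaces.Torus.IsDivFree g → ∃ K : ℝ, ∀ (ν T δ E : ℝ) (φ : ℝ → ℝ) (u₀ : UnitAddTorus (Fin 3) → EuclideanSpace ℝ (Fin 3)) (u : ℝ → UnitAddTorus (Fin 3) → EuclideanSpace ℝ (Fin 3)) (n : ℕ), 0 < ν → ν ≤ 1 → 0 < δ → δ < T → ContDiff ℝ (⊤ : ℕ∞) φ → (∀ s, φ s ≠ 0 → s ∈ Set.Ioo 0 δ) → (∀ s, 0 ≤ φ s) → ∫ s in (0 : ℝ)..δ, φ s = 1 → Literature.Analysis.FluidPDE.Torus.IsGlobalLerayHopf ν (fun t x => φ (T * Int.fract (t / T)) • g x) u₀ u → (∀ t : ℝ, 0 ≤ t → Literature.Analysis.FunctionSpaces.Torus.kineticEnergy (u t) ≤ E) → 1 ≤ n → |(∫ t in ((n : ℝ) * T)..((n : ℝ) * T + δ), φ (t - n * T) * ∫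 x, inner ℝ (g x) (u t x)) - (2⁻¹ * ∫ x, ‖g x‖ ^ 2) - ∫ x, inner ℝ (g x) (u ((n : ℝ) * T) x)| ≤ K * (1 + E) * δ

/-- item stmt-AnomalousDissipation-18238 · support · rank 9 · closed · proved by Summit.AnomalousDissipation.AnomalousDissipation.Theorems.gridThesisOfAcdc_proof @ 026d1bf2647a (prover) · by planner
sources: FoiasManleyRosaTemam2001, DoeringFoias2002
[support] [glue] PROVABLE NOW — PROVED sorry-free (lean check rc 0 / 0 sorries): theorem
gridThesis_of_acdc in Cruxes/GridThesis/Lines/AcdcSplit.lean (commit 8cabd54fa0b7); landable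
VERBATIM as Theorems/ImpulseGridGridThesisSplit.lean (copy attached as evidence on stmt-1770 and on
this item; Theorems/ is prover-only for the strategist seat), after which this item closes by
`theorem gridThesisOfAcdc_proof : GridThesisOfAcdc := fun h₁ h₂ => gridThesis_of_acdc h₁ h₂`
(defeq-checked against these decls). The AC/DC split of GridThesis (BC2 redirect of the RESTATED
deciding crux, crux-strategist 2026-08-17; the `route edit --split` verb is final-cycle-gated for
this seat, so the children are filed as top-level cruxes and this glue carries the assembly). Proof
(~90 lines, real Navier–Stokes content, not a logic seam): parameters (m,A,θ,c) from
AcdcFirstMomentLaw; the fifteen design clauses of the explicit grid (stub_acdcGridAdmissible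
p112659, sawtooth Ψ = (θ/π) sin 2πx₀); the family from AcdcEnergyNoLeak at those parameters; per-j
sup-in-time energy from the Leray–Hopf energy inequality with a mean-zero steady force
(IsGlobalLerayHopf.exists_forall_integral_norm_sq_le_of_hasZeroMean, FMR -/
@[route_item "route-AnomalousDissipation-ImpulseGrid", crux]
def GridThesisOfAcdc : Prop :=
  AcdcFirstMomentLaw → AcdcEnergyNoLeak → GridThesis

/-- item stmt-AnomalousDissipation-1776 · assembly · rank 1 · closed · proved by Summit.AnomalousDissipation.AnomalousDissipation.Theorems.impulseGridAssembly_proof (prover) · by planner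
sources: DoeringFoias2002
[assembly] GridInjectionIdentity → GridThesis → AnomalousDissipation (~200–300 lines). From X take
(Φ,Ψ,G,c,η,Λ,ν,u₀,u,E) and the per-j sup-in-time energy bound (clause of X; =
Correlation.AbsorbingBallLHTorus stmt-0447 for ν_j > 0). For each j, GridInjectionIdentity(1) with
∫ΦΨ|G|² = 0, (a), (b) gives c·Λ⟨(f,u_j)⟩ ≥ η − ν_j|Λ⟨(u_j,Δ(Ψ•G))⟩|; bound |Λ⟨(u_j,ΔΦ₀)⟩| ≤
‖ΔΦ₀‖_∞(1+E)/2 =: K via ‖u‖ ≤ (1+‖u‖²)/2 pointwise, GeneralizedLimit.le_limsup/liminf_le (Cesàro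
means eventually bounded by the sup-energy clause) and limsup timeMean ∫|u_j|² = meanEnergy ≤ E;
choose J with ν_j ≤ η/(2K) for j ≥ J (Tendsto ν atTop (𝓝 0)) and reindex ν' j := ν (j+J), u₀', u';
then Λ⟨(f,u'_j)⟩ ≥ η/(2c) ≤ longTimeAvgSup (Λ ≤ limsup on bounded) ≤ meanDissipation by the no-leak
clause; ε := η/(2c) > 0; f = Φ•G smooth/div-free/mean-zero and the energy bound are copied from X. -/
@[route_item "route-AnomalousDissipation-ImpulseGrid", crux]
def Assembly : Prop :=
  (∀ (Λ : Literature.Analysis.FluidPDE.GeneralizedLimit) (ν c : ℝ) (Φ Ψ : UnitAddTorus (Fin 3) → ℝ) (G : UnitAddTorus (Fin 3) → EuclideanSpace ℝ (Fin 3)) (u₀ : UnitAddTorus (Fin 3) → EuclideanSpace ℝ (Fin 3)) (u : ℝ → UnitAddTorus (Fin 3) → EuclideanSpace ℝ (Fin 3)), 0 < ν → Literature.Analysis.FunctionSpaces.Torus.IsSmooth Φ → Literature.Analysis.FunctionSpaces.Torus.IsSmooth Ψ → Literature.Analysis.FunctionSpaces.Torus.IsSmooth G → (∀ (s : UnitAddCircle)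 x, Ψ (x + Pi.single (1 : Fin 3) s) = Ψ x ∧ Ψ (x + Pi.single (2 : Fin 3) s) = Ψ x) → (∀ (s : UnitAddCircle) x, G (x + Pi.single (0 : Fin 3) s) = G x) → (∀ x, G x 0 = 0) → Literature.Analysis.FunctionSpaces.Torus.IsDivFree G → (∀ x, Literature.Analysis.FunctionSpaces.Torus.partialDeriv 0 Ψ x = Φ x - 1) → Literature.Analysis.FluidPDE.Torus.IsGlobalLerayHopf ν (fun _ => fun x => Φ x • G x) u₀ u → (∃ C : ℝ, ∀ t : ℝ, 0 ≤ t → Literature.Analysis.FunctionSpaces.Torus.kineticEnergy (u t) ≤ C) → c * Λ.longTimeAvg (fun t => ∫ x, inner ℝ (Φ x • G x) (u t x)) = c * Λ.longTimeAvg (fun t => ∫ x, inner ℝ (G x) (u t x)) - Λ.longTimeAvg (fun t => ∫ x, inner ℝ (u t x - c • EuclideanSpace.single 0 1) (Literature.Analysis.FunctionSpaces.Torus.convect (fun y => u t y - c • EuclideanSpace.single 0 1) (fun y => Ψ y • G y) x)) - ν * Λ.longTimeAvg (fun t => ∫ x, inner ℝ (u t x) (Literature.Analysis.FunctionSpaces.Torus.laplacian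 (fun y => Ψ y • G y) x)) - ∫ x, Φ x * Ψ x * ‖G x‖ ^ 2 ∧ Λ.longTimeAvg (fun t => ∫ x, inner ℝ (u t x - c • EuclideanSpace.single 0 1) (Literature.Analysis.FunctionSpaces.Torus.convect (fun y => u t y - c • EuclideanSpace.single 0 1) G x)) = -(∫ x, Φ x * ‖G x‖ ^ 2) - ν * Λ.longTimeAvg (fun t => ∫ x, inner ℝ (u t x) (Literature.Analysis.FunctionSpaces.Torus.laplacian G x))) → (∃ (Φ Ψ : UnitAddTorus (Fin 3) → ℝ) (G : UnitAddTorus (Fin 3) → EuclideanSpace ℝ (Fin 3)) (c η : ℝ) (Λ : Literature.Analysis.FluidPDE.GeneralizedLimit), Literature.Analysis.FunctionSpaces.Torus.IsSmooth Φ ∧ Literature.Analysis.FunctionSpaces.Torus.IsSmooth Ψ ∧ Literature.Analysis.FunctionSpaces.Torus.IsSmooth G ∧ (∀ (s : UnitAddCircle) x, Ψ (x + Pi.single (1 : Fin 3) s) = Ψ x ∧ Ψ (x + Pi.single (2 : Fin 3) s) = Ψ x) ∧ (∀ (s : UnitAddCircle) x, G (x + Pi.single (0 : Fin 3) s) = G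 x) ∧ (∀ x, G x 0 = 0) ∧ Literature.Analysis.FunctionSpaces.Torus.IsDivFree G ∧ (∀ x, Literature.Analysis.FunctionSpaces.Torus.partialDeriv 0 Ψ x = Φ x - 1) ∧ (∫ x, Φ x * Ψ x * ‖G x‖ ^ 2 = 0) ∧ Literature.Analysis.FunctionSpaces.Torus.IsSmooth (fun x => Φ x • G x) ∧ Literature.Analysis.FunctionSpaces.Torus.IsDivFree (fun x => Φ x • G x) ∧ Literature.Analysis.FunctionSpaces.Torus.HasZeroMean (fun x => Φ x • G x) ∧ 0 < c ∧ 0 < η ∧ ∃ (ν : ℕ → ℝ) (u₀ : ℕ → UnitAddTorus (Fin 3) → EuclideanSpace ℝ (Fin 3)) (u : ℕ → ℝ → UnitAddTorus (Fin 3) → EuclideanSpace ℝ (Fin 3)), (∀ j, 0 < ν j) ∧ Filter.Tendsto ν Filter.atTop (nhds 0) ∧ (∀ j, Literature.Analysis.FluidPDE.Torus.IsGlobalLerayHopf (ν j) (fun _ => fun x => Φ x • G x) (u₀ j) (u j)) ∧ (∀ j, ∃ C : ℝ, ∀ t : ℝ, 0 ≤ t → Literature.Analysis.FunctionSpaces.Torus.kineticEnergy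 (u j t) ≤ C) ∧ (∀ j, ∫ x, u₀ j x = c • EuclideanSpace.single 0 1) ∧ (∃ E : ℝ, ∀ j, Literature.Analysis.FluidPDE.meanEnergy (u j) ≤ E) ∧ (∀ j, Literature.Analysis.FluidPDE.longTimeAvgSup (fun t => ∫ x, inner ℝ (Φ x • G x) (u j t x)) ≤ Literature.Analysis.FluidPDE.meanDissipation (ν j) (u j)) ∧ (∀ j, 0 ≤ Λ.longTimeAvg (fun t => ∫ x, inner ℝ (G x) (u j t x))) ∧ (∀ j, Λ.longTimeAvg (fun t => ∫ x, inner ℝ (u j t x - c • EuclideanSpace.single 0 1) (Literature.Analysis.FunctionSpaces.Torus.convect (fun y => u j t y - c • EuclideanSpace.single 0 1) (fun y => Ψ y • G y) x)) ≤ -η)) → AnomalousDissipation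

/-! D-0027 §2.1 — DECIDING THEOREM (planner-authored via `route open/edit --closes-file`; by planner-cstrat-stmt-AnomalousDissipation-1770-r1-0 2026-08-17T02:26:08Z):
its hypotheses are this route's items and its conclusion the sub-problem Statement (glue_lint), and it elaborates with this file. -/

@[closes "route-AnomalousDissipation-ImpulseGrid"] theorem closes : AcdcFirstMomentLaw → AcdcEnergyNoLeak → GridThesisOfAcdc → GridInjectionIdentity → Assembly → _root_.AnomalousDissipation :=
  fun h_AcdcFirstMomentLaw h_AcdcEnergyNoLeak h_GridThesisOfAcdc h_GridInjectionIdentity h_Assembly =>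
    h_Assembly h_GridInjectionIdentity (h_GridThesisOfAcdc h_AcdcFirstMomentLaw h_AcdcEnergyNoLeak)

end Summit.AnomalousDissipation.AnomalousDissipation.Theses.ImpulseGrid
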